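import Literature.Analysis.FunctionSpaces.PolchinskiGaussianSmoothing
import Literature.Analysis.FunctionSpaces.PolchinskiLogSobolevC1
import Literature.Analysis.FunctionSpaces.PolchinskiReparam
import HarnessLib

/-!
# The multiscale Bakry–Émery criterion for bounded measurable initial potentials, by restarting
# the Polchinski flow at a positive scale (Bauerschmidt–Bodineau–Dagallier, Theorem 3 with Def 2 /
# (eq: semigroup structure))

Topic `Literature/Analysis/FunctionSpaces`; companion of `MultiscaleBakryEmery.lean` (the named fact
`BauerschmidtBodineau_multiscaleBakryEmery`, census B16), `PolchinskiLogSobolevC1.lean` (the proved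
[BBD] Theorem 3 for `V₀ ∈ C_b⁴` and `f ∈ C¹_c`), `PolchinskiContinuityAssumption.lean` ((e:continuity)
is automatic for `C_∞ ≻ 0`) and `PolchinskiGaussianSmoothing.lean` (`V_s ∈ C_b^∞` for `s > 0`).

**The restart argument.**  Let `V₀ : ℝ^N → ℝ` be merely MEASURABLE and BOUNDED, and let the covariance
decomposition be nondegenerate (`C_t ≻ 0` for `t > 0`).  For `s > 0` the decomposition restarted at
scale `s` (`CovDecomposition.shift`: `C'_τ = C_{s+τ} − C_s`, `Ċ'_τ = Ċ_{s+τ}`, `C'_∞ = C_∞ − C_s`,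
[BBD] (eq: semigroup structure)) started from `V'_0 = V_s` has `V'_τ = V_{s+τ}` and `ν'_τ = ν_{s+τ}`
(`renormPotential_shift`, `renormExpect_shift`).  Now `V_s ∈ C_b⁴` (Gaussian smoothing), the continuity
assumption holds for the restarted flow (`C_∞ − C_s ≻ 0` for small `s`), and the multiscale condition
(e:assCt-mon) for `(Ċ_t, V_t, λ̇_t)` IS the multiscale condition for the restarted data with rates
`λ̇_{s+τ}`.  Hence the proved Theorem 3 gives the log-Sobolev inequality for `ν_s` with constant
`2∫_s^∞ e^{−2(λ_t − λ_s)} dt` in the `Ċ_s`-metric, for every `s > 0`.  Letting `s → 0⁺` — using only the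
weak continuity `E_{ν_s}[G] → E_{ν₀}[G]` for bounded uniformly continuous `G`, which holds for every
measurable `V₀` bounded below (Gaussian coupling `P_{C_∞} = P_{C_∞−C_s} ∗ P_{C_s}` and the quantitative
`P_{C_s} → δ_0` of the tree, [BBD] Prop 8 proof) — yields (e:LSI) for `ν₀` itself:

  `Ent_{ν₀}(f²) ≤ 2 (∫₀^∞ e^{−2λ_t} dt) · E_{ν₀}[⟨∇f, Ċ₀ ∇f⟩]`,  `f ∈ C¹_c(ℝ^N)`,

with NO regularity hypothesis on `V₀` and NO continuity assumption (e:continuity)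
(`logSobolev_of_multiscaleBakryEmery_of_bounded_measurable`).

Relation to the named fact `BauerschmidtBodineau_multiscaleBakryEmery` (NOT discharged here): that `Prop`
quantifies over `V₀` measurable and bounded BELOW only, over possibly degenerate decompositions, and
assumes `V_t ∈ C²` and (e:continuity); the present theorem removes the last two hypotheses but requires
`V₀` bounded (above and below) and `C_t ≻ 0` for `t > 0`.  -- TODO(general form): `V₀` unbounded above
(relative bounds on `1/Z_t`); degenerate `C_t` (restrict to `im C_∞`).

No claim about Yang–Mills is made: no gauge-theory instance of the multiscale condition exists in print,
the Clay problem is untouched, and in this programme the criterion bears only on the conditional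
finite-`𝕋⁴` rung `BalabanLadder.UV`.

## Main results (sorry-free; no new definitions, no new named facts)

* `tendsto_renormExpect_nhdsGE_zero` — weak continuity `E_{ν_s}[G] → E_{ν₀}[G]` (`s → 0⁺`) for bounded
  uniformly continuous `G` and every measurable `V₀` bounded below (quantitative form
  `abs_renormExpect_sub_integral_nu0_le`).
* `multiscaleCondition_shift` — (e:assCt-mon) transfers to the restarted decomposition.
* `logSobolev_renormExpect_shift` — (e:LSI) for `ν_s`, `s > 0`, bounded measurable `V₀`.
* **`logSobolev_of_multiscaleBakryEmery_of_bounded_measurable`** — (e:LSI) for `ν₀`, bounded measurable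
  `V₀`, nondegenerate decomposition, `f ∈ C¹_c`.
* `CovDecomposition.posDef_C_of_posDef_Cdot_zero`, `logSobolev_of_multiscaleBakryEmery_of_posDef_Cdot_zero`
  — `Ċ₀ ≻ 0 ⟹ C_t ≻ 0` (`t > 0`), so nondegeneracy may be stated on the metric `Ċ₀` of (e:LSI).

## References

* [BauerschmidtBodineauDagallier2023] R. Bauerschmidt, T. Bodineau, B. Dagallier, *Stochastic dynamics
  and the Polchinski equation: an introduction*, Probab. Surveys 21 (2024) 200–290, arXiv:2307.07619 —
  Theorem 3 p0015 L62–90; Definition 2 p0013; (eq: semigroup structure) p0014 L16–22; Remark 2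
  p0015 L100 – p0016 L9 (reparametrisation invariance); Prop 8 (proof: `P_{t,t} = id`). READ (held text).
-/

noncomputable section

open MeasureTheory ProbabilityTheory Filter Topology Set
open scoped RealInnerProductSpace Matrix MatrixOrder ContDiff

namespace Literature.Analysis.FunctionSpaces

namespace Polchinski

variable {N : ℕ} (D : CovDecomposition N) {V₀ : EuclideanSpace ℝ (Fin N) → ℝ}

/-! ### 0. Plumbing -/

section Plumbing

omit D in
/-- A bounded measurable real function is integrable for a finite measure. [folklore] -/
private theorem integrable_of_abs_bound {α : Type*} [MeasurableSpace α] {μ : Measure α}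
    [IsFiniteMeasure μ] {f : α → ℝ} (hf : Measurable f) {M : ℝ} (hM : ∀ x, |f x| ≤ M) :
    Integrable f μ :=
  Integrable.of_bound hf.aestronglyMeasurable M
    (Eventually.of_forall fun x => by rw [Real.norm_eq_abs]; exact hM x)

omit D in
/-- A bounded measurable function has a measurable Gaussian average `φ ↦ E_P[h(φ + ζ)]`. [folklore] -/
private theorem measurable_average_comp_add {h : EuclideanSpace ℝ (Fin N) → ℝ} (hm : Measurable h)
    (P : Measure (EuclideanSpace ℝ (Fin N))) [SFinite P] :
    Measurable fun φ => ∫ ζ, h (φ + ζ) ∂P := by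
  have hsm : StronglyMeasurable
      (Function.uncurry fun (φ ζ : EuclideanSpace ℝ (Fin N)) => h (φ + ζ)) :=
    (hm.comp (measurable_fst.add measurable_snd)).stronglyMeasurable
  exact (hsm.integral_prod_right (ν := P)).measurable

omit D in
/-- `|E_P[h(φ + ·)]| ≤ ‖h‖_∞` for a probability measure `P`. [folklore] -/
private theorem abs_average_comp_add_le {h : EuclideanSpace ℝ (Fin N) → ℝ} {M : ℝ}
    (hM : ∀ z, |h z| ≤ M) (P : Measure (EuclideanSpace ℝ (Fin N))) [IsProbabilityMeasure P]
    (φ : EuclideanSpace ℝ (Fin N)) : |∫ ζ, h (φ + ζ) ∂P| ≤ M := by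
  have h := norm_integral_le_of_norm_le_const (μ := P) (f := fun ζ => h (φ + ζ)) (C := M)
    (Eventually.of_forall fun ζ => by rw [Real.norm_eq_abs]; exact hM _)
  rwa [Real.norm_eq_abs, probReal_univ, mul_one] at h

omit D in
/-- `|⟨v, A v⟩| ≤ (Σ_{kl} |A_{kl}|) ‖v‖²`. [folklore] -/
private theorem abs_inner_toEuclideanLin_le (A : Matrix (Fin N) (Fin N) ℝ)
    (v : EuclideanSpace ℝ (Fin N)) :
    |⟪v, Matrix.toEuclideanLin A v⟫| ≤ (∑ k, ∑ l, |A k l|) * ‖v‖ ^ 2 := by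
  have hv : ∀ i, |v i| ≤ ‖v‖ := fun i => by
    simpa [Real.norm_eq_abs] using PiLp.norm_apply_le v i
  have key : ⟪v, Matrix.toEuclideanLin A v⟫ = ∑ k, ∑ l, A k l * (v k * v l) := by
    rw [EuclideanSpace.inner_eq_star_dotProduct, star_trivial]
    show (A *ᵥ WithLp.ofLp v) ⬝ᵥ WithLp.ofLp v = _
    simp only [dotProduct, Matrix.mulVec, Finset.sum_mul]
    exact Finset.sum_congr rfl fun k _ => Finset.sum_congr rfl fun l _ => by ring
  rw [key, Finset.sum_mul]
  refine (Finset.abs_sum_le_sum_abs _ _).trans (Finset.sum_le_sum fun k _ => ?_)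
  rw [Finset.sum_mul]
  refine (Finset.abs_sum_le_sum_abs _ _).trans (Finset.sum_le_sum fun l _ => ?_)
  calc |A k l * (v k * v l)| = |A k l| * (|v k| * |v l|) := by rw [abs_mul, abs_mul]
    _ ≤ |A k l| * (‖v‖ * ‖v‖) := by gcongr <;> exact hv _
    _ = |A k l| * ‖v‖ ^ 2 := by ring

omit D in
/-- The quadratic form of a positive semidefinite matrix is nonnegative. [folklore] -/
private theorem inner_toEuclideanLin_nonneg {A : Matrix (Fin N) (Fin N) ℝ} (hA : A.PosSemidef)
    (v : EuclideanSpace ℝ (Fin N)) : 0 ≤ ⟪v, Matrix.toEuclideanLin A v⟫ := by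
  have key : ⟪v, Matrix.toEuclideanLin A v⟫ = star (WithLp.ofLp v) ⬝ᵥ (A *ᵥ WithLp.ofLp v) := by
    rw [EuclideanSpace.inner_eq_star_dotProduct, dotProduct_comm]
    rfl
  rw [key]
  exact hA.dotProduct_mulVec_nonneg _

end Plumbing

/-! ### 1. Small scales: `C_s → 0`, and `C_∞ − C_s ≥ (c/2)·1` for `s` small -/

section SmallScales

/-- `C_s → C_0 = 0` entrywise as `s → 0` (`C` is differentiable at `0`).
[cite: BauerschmidtBodineauDagallier2023, §3.1] -/
theorem tendsto_C_nhds_zero (i j : Fin N) : Tendsto (fun s => D.C s i j) (𝓝 0) (𝓝 0) := by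
  have h := (D.hasDerivAt_C 0 le_rfl i j).continuousAt.tendsto
  simpa [D.C_zero] using h

/-- `Ċ_s → Ċ_0` entrywise as `s → 0` (`Ċ` is differentiable at `0`).
[cite: BauerschmidtBodineauDagallier2023, §3.1] -/
theorem tendsto_Cdot_nhds_zero (i j : Fin N) :
    Tendsto (fun s => D.Cdot s i j) (𝓝 0) (𝓝 (D.Cdot 0 i j)) :=
  (D.hasDerivAt_Cdot 0 le_rfl i j).continuousAt.tendsto

/-- `tr C_s → 0` as `s → 0`. [cite: BauerschmidtBodineauDagallier2023, §3.1] -/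
theorem tendsto_trace_C_nhds_zero : Tendsto (fun s => ∑ i, D.C s i i) (𝓝 0) (𝓝 0) := by
  have h := tendsto_finsetSum (Finset.univ : Finset (Fin N)) fun i _ => tendsto_C_nhds_zero D i i
  simpa using h

/-- `Σ_{kl} |(C_s)_{kl}| → 0` as `s → 0`. [cite: BauerschmidtBodineauDagallier2023, §3.1] -/
theorem tendsto_sum_abs_C_nhds_zero : Tendsto (fun s => ∑ k, ∑ l, |D.C s k l|) (𝓝 0) (𝓝 0) := by
  have h := tendsto_finsetSum (Finset.univ : Finset (Fin N)) fun k _ =>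
    tendsto_finsetSum (Finset.univ : Finset (Fin N)) fun l _ => (tendsto_C_nhds_zero D k l).abs
  simpa using h

/-- `Σ_{kl} |(Ċ_s − Ċ_0)_{kl}| → 0` as `s → 0`. [cite: BauerschmidtBodineauDagallier2023, §3.1] -/
theorem tendsto_sum_abs_Cdot_sub_nhds_zero :
    Tendsto (fun s => ∑ k, ∑ l, |D.Cdot s k l - D.Cdot 0 k l|) (𝓝 0) (𝓝 0) := by
  have h0 : ∀ k l, Tendsto (fun s => |D.Cdot s k l - D.Cdot 0 k l|) (𝓝 0) (𝓝 0) := by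
    intro k l
    have h := ((tendsto_Cdot_nhds_zero D k l).sub_const (D.Cdot 0 k l)).abs
    rw [sub_self, abs_zero] at h
    exact h
  have h := tendsto_finsetSum (Finset.univ : Finset (Fin N)) fun k _ =>
    tendsto_finsetSum (Finset.univ : Finset (Fin N)) fun l _ => h0 k l
  simpa using h

/-- **Nondegeneracy propagates to `C_∞`**: if `C_t ≻ 0` for some `t ≥ 0` then `C_∞ ≥ c·1` with
`c > 0` (`C_∞ − C_t ≥ 0`). [cite: BauerschmidtBodineauDagallier2023, §3.1] -/
theorem exists_pos_mul_norm_sq_le_inner_Cinf {t : ℝ} (ht : 0 ≤ t) (hC : (D.C t).PosDef) :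
    ∃ c : ℝ, 0 < c ∧ ∀ v : EuclideanSpace ℝ (Fin N),
      c * ‖v‖ ^ 2 ≤ ⟪v, Matrix.toEuclideanLin D.Cinf v⟫ := by
  obtain ⟨c, hc, hcv⟩ := exists_pos_mul_norm_sq_le_inner_of_posDef hC
  refine ⟨c, hc, fun v => (hcv v).trans ?_⟩
  have h := inner_toEuclideanLin_nonneg (D.posSemidef_Cinf_sub ht) v
  rw [map_sub, LinearMap.sub_apply, inner_sub_right] at h
  linarith

/-- If `C_∞ ≥ c·1` then `C_∞ − C_s ≥ (c/2)·1` for all `s` near `0` (`C_s → 0`).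
[cite: BauerschmidtBodineauDagallier2023, §3.1] -/
theorem eventually_mul_norm_sq_le_inner_Cinf_sub_C {c : ℝ} (hc : 0 < c)
    (hC : ∀ v : EuclideanSpace ℝ (Fin N), c * ‖v‖ ^ 2 ≤ ⟪v, Matrix.toEuclideanLin D.Cinf v⟫) :
    ∀ᶠ s in 𝓝 (0 : ℝ), ∀ v : EuclideanSpace ℝ (Fin N),
      c / 2 * ‖v‖ ^ 2 ≤ ⟪v, Matrix.toEuclideanLin (D.Cinf - D.C s) v⟫ := by
  filter_upwards [(tendsto_order.1 (tendsto_sum_abs_C_nhds_zero D)).2 _ (half_pos hc)] with s hs v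
  rw [map_sub, LinearMap.sub_apply, inner_sub_right]
  have hb := (le_abs_self _).trans (abs_inner_toEuclideanLin_le (D.C s) v)
  nlinarith [hC v, hb, sq_nonneg ‖v‖, hs.le]

end SmallScales

/-! ### 2. Weak continuity of `ν_s` at `s = 0⁺` (no regularity of `V₀`) -/

section WeakContinuity

/-- **Quantitative weak continuity of the renormalised measure at small scales** ([BBD] Def 2 with the
Gaussian decomposition `P_{C_∞} = P_{C_∞−C_s} ∗ P_{C_s}` and the quantitative `P_{C_s} → δ_0` of
[BBD] Prop 8 (proof)): for `V₀` measurable with `V₀ ≥ b`, `s ≥ 0`, and `G` measurable with `|G| ≤ M`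
and `(ε,δ)`-uniformly continuous,
`|E_{ν_s}[G] − E_{ν₀}[G]| ≤ e^{V_∞(0)} e^{−b} (ε + 4M δ⁻² tr C_s)`.  No regularity of `V₀` is used.
[cite: BauerschmidtBodineauDagallier2023, Definition 2 / Proposition 8 (proof)] -/
theorem abs_renormExpect_sub_integral_nu0_le (hV : Measurable V₀) {b : ℝ} (hb : ∀ φ, b ≤ V₀ φ)
    {s : ℝ} (hs : 0 ≤ s) {G : EuclideanSpace ℝ (Fin N) → ℝ} (hGm : Measurable G) {M : ℝ}
    (hGb : ∀ x, |G x| ≤ M) {ε δ : ℝ} (hδ : 0 < δ) (hUC : ∀ x y, ‖x - y‖ < δ → |G x - G y| ≤ ε) :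
    |renormExpect D V₀ s G - ∫ φ, G φ ∂(nu0 D V₀)| ≤
      Real.exp (renormPotentialInf D V₀ 0) * Real.exp (-b) *
        (ε + 2 * (2 * M) / δ ^ 2 * ∑ i, D.C s i i) := by
  set P := multivariateGaussian 0 (D.C s) with hP
  set Q := multivariateGaussian 0 (D.Cinf - D.C s) with hQ
  set a : ℝ := Real.exp (renormPotentialInf D V₀ 0) with ha
  have ha0 : 0 < a := Real.exp_pos _
  set K : ℝ := Real.exp (-b) with hK
  set h₁ : EuclideanSpace ℝ (Fin N) → ℝ := fun x => Real.exp (-V₀ x) with hh₁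
  set h₂ : EuclideanSpace ℝ (Fin N) → ℝ := fun x => Real.exp (-V₀ x) * G x with hh₂
  have hM0 : 0 ≤ M := (abs_nonneg _).trans (hGb 0)
  have hh₁m : Measurable h₁ := hV.neg.exp
  have hh₂m : Measurable h₂ := hV.neg.exp.mul hGm
  have hh₁b : ∀ x, |h₁ x| ≤ K := fun x => by
    rw [hh₁]; simp only [abs_of_pos (Real.exp_pos _)]
    exact Real.exp_le_exp.2 (neg_le_neg (hb x))
  have hh₁le : ∀ x, h₁ x ≤ K := fun x => (le_abs_self _).trans (hh₁b x)
  have hh₁pos : ∀ x, 0 < h₁ x := fun x => Real.exp_pos _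
  have hh₂b : ∀ x, |h₂ x| ≤ K * M := fun x => by
    rw [hh₂]; simp only [abs_mul]
    exact mul_le_mul (hh₁b x) (hGb x) (abs_nonneg _) (Real.exp_pos _).le
  ---------------------------------------------------------------- `E_{ν₀}[G] = a ∫∫ h₂(φ+ζ) dP dQ`
  have hE0 : ∫ φ, G φ ∂(nu0 D V₀) = a * ∫ φ, ∫ ζ, h₂ (φ + ζ) ∂P ∂Q := by
    rw [← renormExpect_zero D hV hb G]
    unfold renormExpect
    simp_rw [renormPotential_zero]
    rw [D.C_zero, sub_zero]
    congr 1
    have h := integral_gaussian_add (D.posSemidef_Cinf_sub hs) (D.posSemidef_C hs) hh₂m hh₂b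
    rw [sub_add_cancel] at h
    exact h
  ---------------------------------------------------------------- `E_{ν_s}[G] = a ∫ Z(φ) G(φ) dQ`
  have hEs : renormExpect D V₀ s G = a * ∫ φ, (∫ ζ, h₁ (φ + ζ) ∂P) * G φ ∂Q := by
    unfold renormExpect
    simp_rw [exp_neg_renormPotential D hV hb s]
    rfl
  ---------------------------------------------------------------- the difference as one double integral
  have iZG : Integrable (fun φ => (∫ ζ, h₁ (φ + ζ) ∂P) * G φ) Q :=
    integrable_of_abs_bound ((measurable_average_comp_add hh₁m P).mul hGm) (M := K * M)
      fun φ => by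
        rw [abs_mul]
        exact mul_le_mul (abs_average_comp_add_le hh₁b P φ) (hGb φ) (abs_nonneg _)
          ((abs_nonneg _).trans (abs_average_comp_add_le hh₁b P φ))
  have iW : Integrable (fun φ => ∫ ζ, h₂ (φ + ζ) ∂P) Q :=
    integrable_of_abs_bound (measurable_average_comp_add hh₂m P) (M := K * M)
      fun φ => abs_average_comp_add_le hh₂b P φ
  have hdiff : renormExpect D V₀ s G - ∫ φ, G φ ∂(nu0 D V₀) =
      a * ∫ φ, (∫ ζ, h₁ (φ + ζ) * (G φ - G (φ + ζ)) ∂P) ∂Q := by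
    rw [hEs, hE0, ← mul_sub, ← integral_sub iZG iW]
    congr 1
    refine integral_congr_ae (Eventually.of_forall fun φ => ?_)
    have i1 : Integrable (fun ζ => h₁ (φ + ζ) * G φ) P :=
      (integrable_of_abs_bound (hh₁m.comp (measurable_const_add φ)) (M := K)
        fun ζ => hh₁b _).mul_const _
    have i2 : Integrable (fun ζ => h₂ (φ + ζ)) P :=
      integrable_of_abs_bound (hh₂m.comp (measurable_const_add φ)) (M := K * M) fun ζ => hh₂b _
    dsimp only
    rw [← integral_mul_const, ← integral_sub i1 i2]
    refine integral_congr_ae (Eventually.of_forall fun ζ => ?_)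
    simp only [hh₂, hh₁]
    ring
  ---------------------------------------------------------------- the inner (coupling) bound
  have hinner : ∀ φ, |∫ ζ, h₁ (φ + ζ) * (G φ - G (φ + ζ)) ∂P| ≤
      K * (ε + 2 * (2 * M) / δ ^ 2 * ∑ i, D.C s i i) := by
    intro φ
    have hHm : Measurable fun z => |G z - G φ| :=
      continuous_abs.measurable.comp (hGm.sub measurable_const)
    have hHb : ∀ z, |(fun z => |G z - G φ|) z| ≤ 2 * M := fun z => by
      dsimp only
      rw [abs_abs]
      exact (abs_sub _ _).trans (by linarith [hGb z, hGb φ])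
    have hHuc : ∀ x y, ‖x - y‖ < δ →
        |(fun z => |G z - G φ|) x - (fun z => |G z - G φ|) y| ≤ ε := fun x y hxy => by
      dsimp only
      refine (abs_abs_sub_abs_le_abs_sub _ _).trans ?_
      rw [sub_sub_sub_cancel_right]
      exact hUC x y hxy
    have hF := abs_integral_shift_sub_le hHm hHb hδ hHuc (D.posSemidef_C hs) φ
    rw [sub_self, abs_zero, sub_zero] at hF
    have hI : ∫ w, |G (φ + w) - G φ| ∂P ≤ ε + 2 * (2 * M) / δ ^ 2 * ∑ i, D.C s i i :=
      (le_abs_self _).trans hF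
    have iR : Integrable (fun ζ => K * |G (φ + ζ) - G φ|) P :=
      (integrable_of_abs_bound (continuous_abs.measurable.comp
        ((hGm.comp (measurable_const_add φ)).sub measurable_const)) (M := 2 * M)
        fun ζ => hHb (φ + ζ)).const_mul K
    calc |∫ ζ, h₁ (φ + ζ) * (G φ - G (φ + ζ)) ∂P|
        ≤ ∫ ζ, |h₁ (φ + ζ) * (G φ - G (φ + ζ))| ∂P := abs_integral_le_integral_abs
      _ ≤ ∫ ζ, K * |G (φ + ζ) - G φ| ∂P := by
          refine integral_mono_of_nonneg (Eventually.of_forall fun ζ => abs_nonneg _) iR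
            (Eventually.of_forall fun ζ => ?_)
          dsimp only
          rw [abs_mul, abs_of_pos (hh₁pos _), abs_sub_comm]
          exact mul_le_mul_of_nonneg_right (hh₁le _) (abs_nonneg _)
      _ = K * ∫ ζ, |G (φ + ζ) - G φ| ∂P := integral_const_mul _ _
      _ ≤ K * (ε + 2 * (2 * M) / δ ^ 2 * ∑ i, D.C s i i) :=
          mul_le_mul_of_nonneg_left hI (Real.exp_pos _).le
  ---------------------------------------------------------------- conclusion
  rw [hdiff, abs_mul, abs_of_pos ha0]
  have h := norm_integral_le_of_norm_le_const (μ := Q)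
    (f := fun φ => ∫ ζ, h₁ (φ + ζ) * (G φ - G (φ + ζ)) ∂P)
    (C := K * (ε + 2 * (2 * M) / δ ^ 2 * ∑ i, D.C s i i))
    (Eventually.of_forall fun φ => by rw [Real.norm_eq_abs]; exact hinner φ)
  rw [Real.norm_eq_abs, probReal_univ, mul_one] at h
  calc a * |∫ φ, (∫ ζ, h₁ (φ + ζ) * (G φ - G (φ + ζ)) ∂P) ∂Q|
      ≤ a * (K * (ε + 2 * (2 * M) / δ ^ 2 * ∑ i, D.C s i i)) := mul_le_mul_of_nonneg_left h ha0.le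
    _ = a * K * (ε + 2 * (2 * M) / δ ^ 2 * ∑ i, D.C s i i) := by ring

/-- **Weak continuity `ν_s → ν₀` as `s → 0⁺`** for bounded uniformly continuous test functions and
every measurable `V₀` bounded below: `E_{ν_s}[G] → E_{ν₀}[G]` along `s → 0`, `s ≥ 0` ([BBD] Def 2;
the case `t ↓ s = 0` of the continuity `P_{s,t} → id`, Prop 8 proof).  No regularity of `V₀` is used.
[cite: BauerschmidtBodineauDagallier2023, Definition 2 / Proposition 8 (proof)] -/
theorem tendsto_renormExpect_nhdsGE_zero (hV : Measurable V₀) {b : ℝ} (hb : ∀ φ, b ≤ V₀ φ)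
    {G : EuclideanSpace ℝ (Fin N) → ℝ} (hGm : Measurable G) {M : ℝ} (hGb : ∀ x, |G x| ≤ M)
    (hGu : UniformContinuous G) :
    Tendsto (fun s => renormExpect D V₀ s G) (𝓝[≥] 0) (𝓝 (∫ φ, G φ ∂(nu0 D V₀))) := by
  rw [Metric.tendsto_nhds]
  intro ε hε
  set c : ℝ := Real.exp (renormPotentialInf D V₀ 0) * Real.exp (-b) with hc
  have hc0 : 0 < c := mul_pos (Real.exp_pos _) (Real.exp_pos _)
  have hM0 : 0 ≤ M := (abs_nonneg _).trans (hGb 0)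
  obtain ⟨δ, hδ, hUC⟩ := Metric.uniformContinuous_iff.1 hGu (ε / (4 * c)) (by positivity)
  have hUC' : ∀ x y, ‖x - y‖ < δ → |G x - G y| ≤ ε / (4 * c) := fun x y hxy => by
    have h := hUC (a := x) (b := y) (by rwa [dist_eq_norm])
    rw [Real.dist_eq] at h
    exact h.le
  have htr : Tendsto (fun s => 2 * (2 * M) / δ ^ 2 * ∑ i, D.C s i i) (𝓝[≥] (0 : ℝ)) (𝓝 0) := by
    have h := ((tendsto_trace_C_nhds_zero D).mono_left
      (nhdsWithin_le_nhds (s := Ici (0 : ℝ)) (a := 0))).const_mul (2 * (2 * M) / δ ^ 2)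
    rwa [mul_zero] at h
  filter_upwards [(tendsto_order.1 htr).2 _ (show (0 : ℝ) < ε / (4 * c) by positivity),
    self_mem_nhdsWithin] with s hs hs0
  have key := abs_renormExpect_sub_integral_nu0_le D hV hb (mem_Ici.1 hs0) hGm hGb hδ hUC'
  rw [Real.dist_eq]
  calc |renormExpect D V₀ s G - ∫ φ, G φ ∂(nu0 D V₀)|
      ≤ c * (ε / (4 * c) + 2 * (2 * M) / δ ^ 2 * ∑ i, D.C s i i) := key
    _ ≤ c * (ε / (4 * c) + ε / (4 * c)) := by gcongr
    _ = ε / 2 := by field_simp; ring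
    _ < ε := half_lt_self hε

/-- **`E_{ν_s}` is `1`-Lipschitz for the sup norm** (`ν_s` is a probability measure, [BBD] Def 2): for
bounded measurable `F, G` with `|F − G| ≤ η` pointwise, `|E_{ν_s}[F] − E_{ν_s}[G]| ≤ η`, `s ≥ 0`.
[cite: BauerschmidtBodineauDagallier2023, Definition 2] -/
theorem abs_renormExpect_sub_renormExpect_le (hV : Measurable V₀) {b : ℝ} (hb : ∀ φ, b ≤ V₀ φ)
    {s : ℝ} (hs : 0 ≤ s) {F G : EuclideanSpace ℝ (Fin N) → ℝ} (hFm : Measurable F)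
    (hGm : Measurable G) {MF MG : ℝ} (hFb : ∀ x, |F x| ≤ MF) (hGb : ∀ x, |G x| ≤ MG) {η : ℝ}
    (hFG : ∀ x, |F x - G x| ≤ η) :
    |renormExpect D V₀ s F - renormExpect D V₀ s G| ≤ η := by
  set μ := (multivariateGaussian 0 (D.Cinf - D.C s)).tilted fun ζ => -renormPotential D V₀ s ζ
    with hμ
  haveI : IsProbabilityMeasure μ :=
    isProbabilityMeasure_tilted (integrable_of_abs_bound (measurable_renormPotential D hV s).neg.exp
      (M := Real.exp (-b)) fun w => by
        rw [abs_of_pos (Real.exp_pos _)]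
        exact Real.exp_le_exp.2 (neg_le_neg (le_renormPotential D hV hb s w)))
  have iF : Integrable F μ := integrable_of_abs_bound hFm hFb
  have iG : Integrable G μ := integrable_of_abs_bound hGm hGb
  rw [renormExpect_eq_integral_tilted D hV hb hs F, renormExpect_eq_integral_tilted D hV hb hs G,
    ← integral_sub iF iG]
  have h := norm_integral_le_of_norm_le_const (μ := μ) (f := fun x => F x - G x) (C := η)
    (Eventually.of_forall fun x => by rw [Real.norm_eq_abs]; exact hFG x)
  rwa [Real.norm_eq_abs, probReal_univ, mul_one] at h

end WeakContinuity

/-! ### 3. The restarted flow satisfies the hypotheses of Theorem 3 -/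

section Shift

/-- **(e:assCt-mon) transfers to the restarted decomposition**: since `V'_τ = V_{s+τ}`, `Ċ'_τ = Ċ_{s+τ}`,
`C̈'_τ = C̈_{s+τ}`, the multiscale Bakry–Émery condition for `(D, V₀, λ̇)` gives the condition for
`(D.shift s, V_s, λ̇_{s+·})` ([BBD] Remark 2: the criterion is invariant under reparametrisation).
[cite: BauerschmidtBodineauDagallier2023, Theorem 3 (e:assCt-mon) / Remark 2] -/
theorem multiscaleCondition_shift (hV : Measurable V₀) {b : ℝ} (hb : ∀ φ, b ≤ V₀ φ)
    {lamdot : ℝ → ℝ} (hMS : MultiscaleCondition D V₀ lamdot) {s : ℝ} (hs : 0 ≤ s) :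
    MultiscaleCondition (D.shift s hs) (renormPotential D V₀ s) fun τ => lamdot (s + τ) := by
  intro φ τ hτ v
  have hfun : renormPotential (D.shift s hs) (renormPotential D V₀ s) τ =
      renormPotential D V₀ (s + τ) :=
    funext fun ψ => renormPotential_shift D hV hb hs hτ.le ψ
  rw [hfun, CovDecomposition.shift_Cdot, CovDecomposition.shift_Cddot]
  exact hMS φ (s + τ) (by linarith) v

omit D in
/-- The shifted rates `λ̇_{s+·}` are locally integrable. [cite: BauerschmidtBodineauDagallier2023, Remark 2] -/
theorem intervalIntegrable_comp_add {lamdot : ℝ → ℝ}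
    (hli : ∀ t, 0 ≤ t → IntervalIntegrable lamdot volume 0 t) {s : ℝ} (hs : 0 ≤ s) {τ : ℝ}
    (hτ : 0 ≤ τ) : IntervalIntegrable (fun x => lamdot (s + x)) volume 0 τ := by
  have h : IntervalIntegrable lamdot volume s (s + τ) :=
    (hli s hs).symm.trans (hli (s + τ) (by linarith))
  have h2 := h.comp_add_left s
  rwa [sub_self, add_sub_cancel_left] at h2

omit D in
/-- The shifted primitive: `λ_{s+τ} − λ_s = ∫₀^τ λ̇_{s+x} dx`. [cite: BauerschmidtBodineauDagallier2023, Remark 2] -/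
theorem sub_eq_integral_comp_add {lamdot lam : ℝ → ℝ}
    (hli : ∀ t, 0 ≤ t → IntervalIntegrable lamdot volume 0 t)
    (hlam : ∀ t, 0 ≤ t → lam t = ∫ x in (0 : ℝ)..t, lamdot x) {s : ℝ} (hs : 0 ≤ s) {τ : ℝ}
    (hτ : 0 ≤ τ) : lam (s + τ) - lam s = ∫ x in (0 : ℝ)..τ, lamdot (s + x) := by
  rw [intervalIntegral.integral_comp_add_left, add_zero, hlam s hs, hlam (s + τ) (by linarith),
    ← intervalIntegral.integral_add_adjacent_intervals (hli s hs)
      ((hli s hs).symm.trans (hli (s + τ) (by linarith)))]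
  ring

omit D in
/-- Translation of indicators: `1_{(0,∞)}(τ) g(s+τ) = (1_{(s,∞)} g)(s+τ)`. [folklore] -/
private theorem indicator_Ioi_comp_add (g : ℝ → ℝ) (s : ℝ) :
    (Ioi 0).indicator (fun τ => g (s + τ)) = fun τ => (Ioi s).indicator g (s + τ) := by
  funext τ
  simp only [Set.indicator_apply, mem_Ioi, lt_add_iff_pos_right]

omit D in
/-- `∫_{(0,∞)} g(s + τ) dτ = ∫_{(s,∞)} g`. [folklore] -/
private theorem integral_Ioi_comp_add (g : ℝ → ℝ) (s : ℝ) :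
    ∫ τ in Ioi 0, g (s + τ) = ∫ t in Ioi s, g t := by
  rw [← integral_indicator measurableSet_Ioi, ← integral_indicator measurableSet_Ioi,
    indicator_Ioi_comp_add]
  exact integral_add_left_eq_self _ s

omit D in
/-- `g` integrable on `(s,∞)` ⟹ `g(s+·)` integrable on `(0,∞)`. [folklore] -/
private theorem integrableOn_Ioi_comp_add {g : ℝ → ℝ} {s : ℝ} (hg : IntegrableOn g (Ioi s)) :
    IntegrableOn (fun τ => g (s + τ)) (Ioi 0) := by
  rw [← integrable_indicator_iff measurableSet_Ioi] at hg ⊢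
  rw [indicator_Ioi_comp_add]
  exact hg.comp_add_left s

omit D in
/-- The shifted integrability: `∫₀^∞ e^{−2(λ_{s+τ} − λ_s)} dτ < ∞`. [cite: BauerschmidtBodineauDagallier2023, Remark 2] -/
theorem integrableOn_exp_sub {lam : ℝ → ℝ}
    (hexp : IntegrableOn (fun t => Real.exp (-2 * lam t)) (Ioi 0)) {s : ℝ} (hs : 0 ≤ s) :
    IntegrableOn (fun τ => Real.exp (-2 * (lam (s + τ) - lam s))) (Ioi 0) := by
  have h1 : IntegrableOn (fun τ => Real.exp (-2 * lam (s + τ))) (Ioi 0) :=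
    integrableOn_Ioi_comp_add (g := fun t => Real.exp (-2 * lam t))
      (hexp.mono_set (Ioi_subset_Ioi hs))
  refine IntegrableOn.congr_fun (f := fun τ => Real.exp (2 * lam s) * Real.exp (-2 * lam (s + τ)))
    (h1.const_mul (Real.exp (2 * lam s))) (fun τ _ => ?_) measurableSet_Ioi
  show Real.exp (2 * lam s) * Real.exp (-2 * lam (s + τ)) = Real.exp (-2 * (lam (s + τ) - lam s))
  rw [← Real.exp_add]
  congr 1
  ring

omit D in
/-- The shifted constant: `∫₀^∞ e^{−2(λ_{s+τ} − λ_s)} dτ = e^{2λ_s} ∫_s^∞ e^{−2λ_t} dt`.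
[cite: BauerschmidtBodineauDagallier2023, Remark 2] -/
theorem integral_exp_sub (lam : ℝ → ℝ) (s : ℝ) :
    ∫ τ in Ioi 0, Real.exp (-2 * (lam (s + τ) - lam s)) =
      Real.exp (2 * lam s) * ∫ t in Ioi s, Real.exp (-2 * lam t) := by
  rw [← integral_Ioi_comp_add (fun t => Real.exp (-2 * lam t)) s, ← integral_const_mul]
  refine setIntegral_congr_fun measurableSet_Ioi fun τ _ => ?_
  show Real.exp (-2 * (lam (s + τ) - lam s)) = Real.exp (2 * lam s) * Real.exp (-2 * lam (s + τ))
  rw [← Real.exp_add]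
  congr 1
  ring

end Shift

/-! ### 4. The log-Sobolev inequality at positive scale, and the limit `s → 0⁺` -/

section Main

/-- **(e:LSI) for the renormalised measure `ν_s`, `s > 0`, bounded measurable `V₀`** ([BBD] Theorem 3
applied to the flow restarted at scale `s`): if `|V₀| ≤ B` is measurable, `C_s ≻ 0`, `C_∞ − C_s ≥ c·1`
with `c > 0`, and (e:assCt-mon) holds with rates `λ̇_t`, then for every `f ∈ C¹_c`,
`Ent_{ν_s}(f²) ≤ 2 (∫₀^∞ e^{−2(λ_{s+τ}−λ_s)} dτ) · E_{ν_s}[⟨∇f, Ċ_s ∇f⟩]`.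
[cite: BauerschmidtBodineauDagallier2023, Theorem 3 / Definition 2 (eq: semigroup structure)] -/
theorem logSobolev_renormExpect_shift (hV : Measurable V₀) {BV : ℝ} (hVB : ∀ x, |V₀ x| ≤ BV)
    {lamdot lam : ℝ → ℝ} (hMS : MultiscaleCondition D V₀ lamdot)
    (hli : ∀ t, 0 ≤ t → IntervalIntegrable lamdot volume 0 t)
    (hlam : ∀ t, 0 ≤ t → lam t = ∫ x in (0 : ℝ)..t, lamdot x)
    (hexp : IntegrableOn (fun t => Real.exp (-2 * lam t)) (Ioi 0))
    {s : ℝ} (hs : 0 < s) (hCs : (D.C s).PosDef) {c : ℝ} (hc : 0 < c)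
    (hCinf : ∀ v : EuclideanSpace ℝ (Fin N),
      c * ‖v‖ ^ 2 ≤ ⟪v, Matrix.toEuclideanLin (D.Cinf - D.C s) v⟫)
    (f : EuclideanSpace ℝ (Fin N) → ℝ) (hf : ContDiff ℝ 1 f) (hfc : HasCompactSupport f) :
    renormExpect D V₀ s (fun φ => f φ ^ 2 * Real.log (f φ ^ 2)) -
        renormExpect D V₀ s (fun φ => f φ ^ 2) *
          Real.log (renormExpect D V₀ s (fun φ => f φ ^ 2)) ≤
      2 * (∫ τ in Ioi (0 : ℝ), Real.exp (-2 * (lam (s + τ) - lam s))) *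
        renormExpect D V₀ s (fun φ =>
          ⟪gradient f φ, Matrix.toEuclideanLin (D.Cdot s) (gradient f φ)⟫) := by
  have hb : ∀ φ, -BV ≤ V₀ φ := fun φ => (abs_le.1 (hVB φ)).1
  have hV'm : Measurable (renormPotential D V₀ s) := measurable_renormPotential D hV s
  have hb' : ∀ φ, -BV ≤ renormPotential D V₀ s φ := fun φ => le_renormPotential D hV hb s φ
  -- (i) `V_s ∈ C_b⁴`
  have hV'4 : ContDiff ℝ 4 (renormPotential D V₀ s) :=
    (contDiff_renormPotential_of_posDef D hV hVB hCs).of_le (WithTop.coe_le_coe.2 le_top)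
  obtain ⟨B', hB'⟩ := exists_bound_iteratedFDeriv_renormPotential_of_posDef D hV hVB hCs 4
  -- (ii) the continuity assumption for the restarted flow
  have hCA' : ContinuityAssumption (D.shift s hs.le) (renormPotential D V₀ s) :=
    continuityAssumption_of_le_inner_Cinf (D.shift s hs.le) hV'm hb' hc hCinf
  -- (iii) the multiscale condition for the restarted flow
  have hMS' := multiscaleCondition_shift D hV hb hMS hs.le
  -- (iv) the shifted rates
  have hli' : ∀ τ, 0 ≤ τ → IntervalIntegrable (fun x => lamdot (s + x)) volume 0 τ :=
    fun τ hτ => intervalIntegrable_comp_add hli hs.le hτ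
  have hlam' : ∀ τ, 0 ≤ τ →
      (fun τ => lam (s + τ) - lam s) τ = ∫ x in (0 : ℝ)..τ, (fun x => lamdot (s + x)) x :=
    fun τ hτ => sub_eq_integral_comp_add hli hlam hs.le hτ
  have hexp' := integrableOn_exp_sub hexp hs.le
  -- (v) Theorem 3 for the restarted flow
  have h := logSobolev_of_multiscaleBakryEmery_of_contDiff_one (D.shift s hs.le) hV'4 hB' hCA' hMS'
    hli' hlam' hexp' f hf hfc
  -- (vi) `ν'_0 = ν_s`
  have hconv : ∀ G : EuclideanSpace ℝ (Fin N) → ℝ,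
      ∫ φ, G φ ∂(nu0 (D.shift s hs.le) (renormPotential D V₀ s)) = renormExpect D V₀ s G := by
    intro G
    rw [← renormExpect_zero (D.shift s hs.le) hV'm hb' G, renormExpect_shift D hV hb hs.le le_rfl G,
      add_zero]
  rw [hconv (fun φ => f φ ^ 2 * Real.log (f φ ^ 2)), hconv (fun φ => f φ ^ 2),
    hconv (fun φ => ⟪gradient f φ, Matrix.toEuclideanLin ((D.shift s hs.le).Cdot 0) (gradient f φ)⟫)]
    at h
  simpa only [CovDecomposition.shift_Cdot, add_zero] using h

/-- **[BBD] Theorem 3 for bounded measurable initial potentials** — the multiscale Bakry–Émery criterion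
in log-Sobolev form with NO regularity hypothesis on `V₀` and NO continuity assumption (e:continuity):
let `C_∞ = ∫₀^∞ Ċ_t dt` be a covariance decomposition on `ℝ^N` with `C_t ≻ 0` for `t > 0`, let
`V₀ : ℝ^N → ℝ` be measurable and bounded, `ν₀ ∝ e^{−V₀} dP_{C_∞}`.  IF there are rates `λ̇_t`, locally
integrable, with `Ċ_t Hess V_t(φ) Ċ_t − ½ C̈_t ≥ λ̇_t Ċ_t` for all `φ` and `t > 0`, and
`∫₀^∞ e^{−2λ_t} dt < ∞` (`λ_t = ∫₀^t λ̇`), THEN for every `f ∈ C¹_c(ℝ^N)`,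
`Ent_{ν₀}(f²) ≤ 2 (∫₀^∞ e^{−2λ_t} dt) · E_{ν₀}[⟨∇f, Ċ₀ ∇f⟩]`.
Proof: (e:LSI) for `ν_s`, `s > 0` (`logSobolev_renormExpect_shift`: restart at scale `s`, where
`V_s ∈ C_b⁴` and (e:continuity) holds), then `s → 0⁺` by weak continuity of `ν_s`.  This narrows the gap
to the named fact `BauerschmidtBodineau_multiscaleBakryEmery` (census B16) to: `V₀` unbounded above;
degenerate `C_t`.  Nothing here concerns Yang–Mills (no gauge instance of (e:assCt-mon) is in print).
[cite: BauerschmidtBodineauDagallier2023, Theorem 3] -/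
theorem logSobolev_of_multiscaleBakryEmery_of_bounded_measurable
    (hCpos : ∀ t, 0 < t → (D.C t).PosDef)
    (hV : Measurable V₀) {BV : ℝ} (hVB : ∀ x, |V₀ x| ≤ BV)
    {lamdot lam : ℝ → ℝ} (hMS : MultiscaleCondition D V₀ lamdot)
    (hli : ∀ t, 0 ≤ t → IntervalIntegrable lamdot volume 0 t)
    (hlam : ∀ t, 0 ≤ t → lam t = ∫ x in (0 : ℝ)..t, lamdot x)
    (hexp : IntegrableOn (fun t => Real.exp (-2 * lam t)) (Ioi 0))
    (f : EuclideanSpace ℝ (Fin N) → ℝ) (hf : ContDiff ℝ 1 f) (hfc : HasCompactSupport f) :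
    ∫ φ, f φ ^ 2 * Real.log (f φ ^ 2) ∂(nu0 D V₀) -
        (∫ φ, f φ ^ 2 ∂(nu0 D V₀)) * Real.log (∫ φ, f φ ^ 2 ∂(nu0 D V₀)) ≤
      2 * (∫ t in Ioi (0 : ℝ), Real.exp (-2 * lam t)) *
        ∫ φ, ⟪gradient f φ, Matrix.toEuclideanLin (D.Cdot 0) (gradient f φ)⟫ ∂(nu0 D V₀) := by
  have hb : ∀ φ, -BV ≤ V₀ φ := fun φ => (abs_le.1 (hVB φ)).1
  set ν := nu0 D V₀ with hν
  set I : ℝ := ∫ t in Ioi (0 : ℝ), Real.exp (-2 * lam t) with hI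
  ---------------------------------------------------------------- the test functions
  set G₁ : EuclideanSpace ℝ (Fin N) → ℝ := fun φ => f φ ^ 2 * Real.log (f φ ^ 2) with hG₁
  set G₂ : EuclideanSpace ℝ (Fin N) → ℝ := fun φ => f φ ^ 2 with hG₂
  set Q : ℝ → EuclideanSpace ℝ (Fin N) → ℝ := fun t φ =>
    ⟪gradient f φ, Matrix.toEuclideanLin (D.Cdot t) (gradient f φ)⟫ with hQ
  have hfcont : Continuous f := hf.continuous
  have hgrad : gradient f = fun x => (InnerProductSpace.toDual ℝ (EuclideanSpace ℝ (Fin N))).symm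
      (fderiv ℝ f x) := rfl
  have hgcont : Continuous (gradient f) := by
    rw [hgrad]
    exact (InnerProductSpace.toDual ℝ (EuclideanSpace ℝ (Fin N))).symm.continuous.comp
      (hf.continuous_fderiv one_ne_zero)
  have hgc : HasCompactSupport (gradient f) := by
    rw [hgrad]
    exact (hfc.fderiv (𝕜 := ℝ)).comp_left (map_zero _)
  obtain ⟨Bg, hBg⟩ : ∃ B, ∀ x, ‖gradient f x‖ ≤ B := hgcont.bounded_above_of_compact_support hgc
  have hBg0 : 0 ≤ Bg := (norm_nonneg _).trans (hBg 0)
  -- continuity, compact support, bounds, uniform continuity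
  have hG₁c : Continuous G₁ := Real.continuous_mul_log.comp (hfcont.pow 2)
  have hG₂c : Continuous G₂ := hfcont.pow 2
  have hQc : ∀ t, Continuous (Q t) := fun t =>
    hgcont.inner ((Matrix.toEuclideanLin (D.Cdot t)).continuous_of_finiteDimensional.comp hgcont)
  have hG₁s : HasCompactSupport G₁ :=
    hfc.comp_left (g := fun y : ℝ => y ^ 2 * Real.log (y ^ 2)) (by simp)
  have hG₂s : HasCompactSupport G₂ := hfc.comp_left (g := fun y : ℝ => y ^ 2) (by simp)
  have hQs : ∀ t, HasCompactSupport (Q t) := fun t =>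
    hgc.comp_left (g := fun v => ⟪v, Matrix.toEuclideanLin (D.Cdot t) v⟫) (by simp)
  obtain ⟨M₁, hM₁⟩ : ∃ B, ∀ x, ‖G₁ x‖ ≤ B := hG₁c.bounded_above_of_compact_support hG₁s
  obtain ⟨M₂, hM₂⟩ : ∃ B, ∀ x, ‖G₂ x‖ ≤ B := hG₂c.bounded_above_of_compact_support hG₂s
  have hQb : ∀ t x, |Q t x| ≤ (∑ k, ∑ l, |D.Cdot t k l|) * Bg ^ 2 := fun t x =>
    (abs_inner_toEuclideanLin_le _ _).trans (mul_le_mul_of_nonneg_left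
      (pow_le_pow_left₀ (norm_nonneg _) (hBg x) 2)
      (Finset.sum_nonneg fun k _ => Finset.sum_nonneg fun l _ => abs_nonneg _))
  have hG₁u : UniformContinuous G₁ := hG₁s.uniformContinuous_of_continuous hG₁c
  have hG₂u : UniformContinuous G₂ := hG₂s.uniformContinuous_of_continuous hG₂c
  have hQu : UniformContinuous (Q 0) := (hQs 0).uniformContinuous_of_continuous (hQc 0)
  ---------------------------------------------------------------- the three weak limits
  have hA : Tendsto (fun s => renormExpect D V₀ s G₁) (𝓝[>] 0) (𝓝 (∫ φ, G₁ φ ∂ν)) :=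
    (tendsto_renormExpect_nhdsGE_zero D hV hb hG₁c.measurable
      (fun x => Real.norm_eq_abs _ ▸ hM₁ x) hG₁u).mono_left (nhdsWithin_mono _ Ioi_subset_Ici_self)
  have hB : Tendsto (fun s => renormExpect D V₀ s G₂) (𝓝[>] 0) (𝓝 (∫ φ, G₂ φ ∂ν)) :=
    (tendsto_renormExpect_nhdsGE_zero D hV hb hG₂c.measurable
      (fun x => Real.norm_eq_abs _ ▸ hM₂ x) hG₂u).mono_left (nhdsWithin_mono _ Ioi_subset_Ici_self)
  have hC0 : Tendsto (fun s => renormExpect D V₀ s (Q 0)) (𝓝[>] 0) (𝓝 (∫ φ, Q 0 φ ∂ν)) :=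
    (tendsto_renormExpect_nhdsGE_zero D hV hb (hQc 0).measurable (hQb 0) hQu).mono_left
      (nhdsWithin_mono _ Ioi_subset_Ici_self)
  -- the `s`-dependent energy integrand: `|E_{ν_s}[Q_s] − E_{ν_s}[Q_0]| ≤ (Σ|Ċ_s − Ċ_0|) Bg²`
  have hQdiff : ∀ s x, |Q s x - Q 0 x| ≤ (∑ k, ∑ l, |D.Cdot s k l - D.Cdot 0 k l|) * Bg ^ 2 := by
    intro s x
    have e : Q s x - Q 0 x = ⟪gradient f x, Matrix.toEuclideanLin (D.Cdot s - D.Cdot 0)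
        (gradient f x)⟫ := by
      simp only [hQ, map_sub, LinearMap.sub_apply, inner_sub_right]
    rw [e]
    refine (abs_inner_toEuclideanLin_le _ _).trans ?_
    simp only [Matrix.sub_apply]
    exact mul_le_mul_of_nonneg_left (pow_le_pow_left₀ (norm_nonneg _) (hBg x) 2)
      (Finset.sum_nonneg fun k _ => Finset.sum_nonneg fun l _ => abs_nonneg _)
  have hη : Tendsto (fun s => (∑ k, ∑ l, |D.Cdot s k l - D.Cdot 0 k l|) * Bg ^ 2) (𝓝[>] 0)
      (𝓝 0) := by
    have h := ((tendsto_sum_abs_Cdot_sub_nhds_zero D).mono_left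
      (nhdsWithin_le_nhds (s := Ioi (0 : ℝ)) (a := 0))).mul_const (Bg ^ 2)
    rwa [zero_mul] at h
  have hC : Tendsto (fun s => renormExpect D V₀ s (Q s)) (𝓝[>] 0) (𝓝 (∫ φ, Q 0 φ ∂ν)) := by
    refine hC0.congr_dist (squeeze_zero' (Eventually.of_forall fun s => dist_nonneg) ?_ hη)
    filter_upwards [self_mem_nhdsWithin] with s hs
    rw [Real.dist_eq]
    exact abs_renormExpect_sub_renormExpect_le D hV hb (le_of_lt hs) (hQc 0).measurable
      (hQc s).measurable (hQb 0) (hQb s) fun x => by rw [abs_sub_comm]; exact hQdiff s x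
  ---------------------------------------------------------------- the constants
  -- `λ_s → 0`
  have hlam0 : Tendsto lam (𝓝[>] 0) (𝓝 0) := by
    have hprim : ContinuousOn (fun t => ∫ x in (0 : ℝ)..t, lamdot x) (uIcc 0 1) :=
      intervalIntegral.continuousOn_primitive_interval' (hli 1 zero_le_one) left_mem_uIcc
    have h0 : ContinuousWithinAt (fun t => ∫ x in (0 : ℝ)..t, lamdot x) (Ici 0) 0 := by
      rw [← continuousWithinAt_Icc_iff_Ici zero_lt_one]
      have h := hprim 0 left_mem_uIcc
      rwa [uIcc_of_le zero_le_one] at h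
    have h1 : Tendsto (fun t => ∫ x in (0 : ℝ)..t, lamdot x) (𝓝[>] 0) (𝓝 0) := by
      have h := h0.tendsto.mono_left (nhdsWithin_mono (0 : ℝ) Ioi_subset_Ici_self)
      simpa using h
    refine h1.congr' ?_
    filter_upwards [self_mem_nhdsWithin] with t ht
    exact (hlam t (le_of_lt ht)).symm
  -- `∫_s^∞ e^{−2λ} → ∫_0^∞ e^{−2λ}`
  have htail : Tendsto (fun s => ∫ t in Ioi s, Real.exp (-2 * lam t)) (𝓝[>] 0) (𝓝 I) := by
    have hii : IntervalIntegrable (fun t => Real.exp (-2 * lam t)) volume 0 1 := by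
      rw [intervalIntegrable_iff_integrableOn_Ioc_of_le zero_le_one]
      exact hexp.mono_set Ioc_subset_Ioi_self
    have hprim : ContinuousOn (fun s => ∫ x in (0 : ℝ)..s, Real.exp (-2 * lam x)) (uIcc 0 1) :=
      intervalIntegral.continuousOn_primitive_interval' hii left_mem_uIcc
    have h0 : ContinuousWithinAt (fun s => ∫ x in (0 : ℝ)..s, Real.exp (-2 * lam x)) (Ici 0) 0 := by
      rw [← continuousWithinAt_Icc_iff_Ici zero_lt_one]
      have h := hprim 0 left_mem_uIcc
      rwa [uIcc_of_le zero_le_one] at h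
    have h1 : Tendsto (fun s => I - ∫ x in (0 : ℝ)..s, Real.exp (-2 * lam x)) (𝓝[>] 0) (𝓝 I) := by
      have h := (h0.tendsto.mono_left (nhdsWithin_mono (0 : ℝ) Ioi_subset_Ici_self)).const_sub I
      simpa using h
    refine h1.congr' ?_
    filter_upwards [self_mem_nhdsWithin] with s hs
    have hs' : 0 < s := hs
    have hsplit := setIntegral_union (Ioc_disjoint_Ioi_same (a := (0 : ℝ)) (b := s))
      measurableSet_Ioi (hexp.mono_set Ioc_subset_Ioi_self) (hexp.mono_set (Ioi_subset_Ioi hs'.le))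
    rw [Ioc_union_Ioi_eq_Ioi hs'.le] at hsplit
    rw [intervalIntegral.integral_of_le hs'.le, hI, hsplit]
    ring
  have hK : Tendsto (fun s => ∫ τ in Ioi (0 : ℝ), Real.exp (-2 * (lam (s + τ) - lam s))) (𝓝[>] 0)
      (𝓝 I) := by
    simp only [integral_exp_sub]
    have he : Tendsto (fun s => Real.exp (2 * lam s)) (𝓝[>] 0) (𝓝 1) := by
      have h := (Real.continuous_exp.tendsto _).comp (hlam0.const_mul 2)
      rw [mul_zero, Real.exp_zero] at h
      exact h
    have h := he.mul htail
    rwa [one_mul] at h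
  ---------------------------------------------------------------- (e:LSI) for `ν_s`, eventually in `s`
  obtain ⟨c, hc, hCinf⟩ := exists_pos_mul_norm_sq_le_inner_Cinf D zero_le_one (hCpos 1 one_pos)
  have hP : ∀ᶠ s in 𝓝[>] (0 : ℝ),
      renormExpect D V₀ s G₁ - renormExpect D V₀ s G₂ * Real.log (renormExpect D V₀ s G₂) ≤
        2 * (∫ τ in Ioi (0 : ℝ), Real.exp (-2 * (lam (s + τ) - lam s))) *
          renormExpect D V₀ s (Q s) := by
    filter_upwards [self_mem_nhdsWithin,
      nhdsWithin_le_nhds (eventually_mul_norm_sq_le_inner_Cinf_sub_C D hc hCinf)] with s hs hlow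
    exact logSobolev_renormExpect_shift D hV hVB hMS hli hlam hexp hs (hCpos s hs) (half_pos hc)
      hlow f hf hfc
  ---------------------------------------------------------------- pass to the limit
  have hL : Tendsto (fun s => renormExpect D V₀ s G₁ -
      renormExpect D V₀ s G₂ * Real.log (renormExpect D V₀ s G₂)) (𝓝[>] 0)
      (𝓝 ((∫ φ, G₁ φ ∂ν) - (∫ φ, G₂ φ ∂ν) * Real.log (∫ φ, G₂ φ ∂ν))) :=
    hA.sub ((Real.continuous_mul_log.tendsto _).comp hB)
  have hR : Tendsto (fun s => 2 * (∫ τ in Ioi (0 : ℝ), Real.exp (-2 * (lam (s + τ) - lam s))) *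
      renormExpect D V₀ s (Q s)) (𝓝[>] 0) (𝓝 (2 * I * ∫ φ, Q 0 φ ∂ν)) :=
    (hK.const_mul 2).mul hC
  exact le_of_tendsto_of_tendsto hL hR hP

end Main

/-! ### 5. Nondegeneracy from the metric `Ċ₀ ≻ 0` -/

section Nondegenerate

/-- **`Ċ₀ ≻ 0 ⟹ C_t ≻ 0` for every `t > 0`** (`C_0 = 0`, `d/dt (x, C_t x) = (x, Ċ_t x)`, and
`(x, C_t x)` is nondecreasing in `t`): nondegeneracy of the log-Sobolev metric `Ċ₀` of (e:LSI) makes the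
whole decomposition nondegenerate. [cite: BauerschmidtBodineauDagallier2023, §3.1] -/
theorem CovDecomposition.posDef_C_of_posDef_Cdot_zero (h0 : (D.Cdot 0).PosDef) {t : ℝ}
    (ht : 0 < t) : (D.C t).PosDef := by
  refine Matrix.PosDef.of_dotProduct_mulVec_pos (D.isHermitian_C ht.le) fun x hx => ?_
  rw [star_trivial]
  -- the quadratic form `q(s) = (x, C_s x)` has `q(0) = 0` and `q'(0) = (x, Ċ₀ x) > 0`
  have hq0 : x ⬝ᵥ (D.C 0 *ᵥ x) = 0 := by simp [D.C_zero]
  have hq' : 0 < x ⬝ᵥ (D.Cdot 0 *ᵥ x) := by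
    have h := h0.dotProduct_mulVec_pos hx
    rwa [star_trivial] at h
  have hslope : Tendsto (slope (fun s => x ⬝ᵥ (D.C s *ᵥ x)) 0) (𝓝[≠] 0)
      (𝓝 (x ⬝ᵥ (D.Cdot 0 *ᵥ x))) :=
    hasDerivAt_iff_tendsto_slope.1 (D.hasDerivAt_quadForm_C x le_rfl)
  have hev : ∀ᶠ s in 𝓝[>] (0 : ℝ), 0 < slope (fun s => x ⬝ᵥ (D.C s *ᵥ x)) 0 s :=
    (hslope.mono_left (nhdsWithin_mono _ fun s hs => ne_of_gt hs)).eventually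
      (eventually_gt_nhds hq')
  obtain ⟨s, hs, hst⟩ := (hev.and (Ioo_mem_nhdsGT ht)).exists
  -- `q(s) = s · slope > 0` and `q(t) ≥ q(s)`
  have hqs : 0 < x ⬝ᵥ (D.C s *ᵥ x) := by
    rw [slope_def_field, hq0, sub_zero, sub_zero] at hs
    have h := mul_pos hs hst.1
    rwa [div_mul_cancel₀ _ hst.1.ne'] at h
  exact hqs.trans_le (D.quadForm_C_mono x hst.1.le hst.2.le)

/-- **[BBD] Theorem 3 for bounded measurable `V₀`, nondegeneracy stated on the metric `Ċ₀`**: the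
conclusion of `logSobolev_of_multiscaleBakryEmery_of_bounded_measurable` under `Ċ₀ ≻ 0` (instead of
`C_t ≻ 0` for `t > 0`): for `V₀` measurable with `|V₀| ≤ B`, (e:assCt-mon) with locally integrable rates
and `∫₀^∞ e^{−2λ_t} dt < ∞`, every `f ∈ C¹_c` satisfies
`Ent_{ν₀}(f²) ≤ 2 (∫₀^∞ e^{−2λ_t} dt) · E_{ν₀}[⟨∇f, Ċ₀ ∇f⟩]` — no regularity of `V₀`, no (e:continuity).
Nothing here concerns Yang–Mills. [cite: BauerschmidtBodineauDagallier2023, Theorem 3] -/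
theorem logSobolev_of_multiscaleBakryEmery_of_posDef_Cdot_zero
    (h0 : (D.Cdot 0).PosDef)
    (hV : Measurable V₀) {BV : ℝ} (hVB : ∀ x, |V₀ x| ≤ BV)
    {lamdot lam : ℝ → ℝ} (hMS : MultiscaleCondition D V₀ lamdot)
    (hli : ∀ t, 0 ≤ t → IntervalIntegrable lamdot volume 0 t)
    (hlam : ∀ t, 0 ≤ t → lam t = ∫ x in (0 : ℝ)..t, lamdot x)
    (hexp : IntegrableOn (fun t => Real.exp (-2 * lam t)) (Ioi 0))
    (f : EuclideanSpace ℝ (Fin N) → ℝ) (hf : ContDiff ℝ 1 f) (hfc : HasCompactSupport f) :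
    ∫ φ, f φ ^ 2 * Real.log (f φ ^ 2) ∂(nu0 D V₀) -
        (∫ φ, f φ ^ 2 ∂(nu0 D V₀)) * Real.log (∫ φ, f φ ^ 2 ∂(nu0 D V₀)) ≤
      2 * (∫ t in Ioi (0 : ℝ), Real.exp (-2 * lam t)) *
        ∫ φ, ⟪gradient f φ, Matrix.toEuclideanLin (D.Cdot 0) (gradient f φ)⟫ ∂(nu0 D V₀) :=
  logSobolev_of_multiscaleBakryEmery_of_bounded_measurable D
    (fun _ ht => D.posDef_C_of_posDef_Cdot_zero h0 ht) hV hVB hMS hli hlam hexp f hf hfc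

end Nondegenerate

end Polchinski

end Literature.Analysis.FunctionSpaces

end
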